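import Summits.Parity.GeneralizedHardyLittlewood.Theorems.LiouvilleShiftedTablesEngineToPairsSieveCaseBoxed

/-!
# Correlation sieve for line `Sketch` of the crux `EngineToPairs` (stmt-Parity-14659), part 6b:
# the bound for a fully boxed tuple with at most one high smooth factor

Support file for the stub `stub_sieve : CorrelationSieveFamily`, continuing part 6a (`…SieveCaseBoxed`).

* `tuple_bound_boxed` — for `Large δ x`, `j ∈ {1,2,3}`, `U ≤ 2x^{1/3}`, `L` with `#L ≤ 1`
  and any box-tuple `κ`: `∑_q |corrFun (w q) x (∏_i gF i)| ≤ 4 (log x)² (TI + TII)` under the Type-I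
  family hypothesis (level `x^{1/2−2δ}`, `B = 6`) and the Type-II family hypothesis (`θ = δ/2`,
  `θ + ν = 1/3 + δ`, `B = 6`).  Proof: discard unit boxes; if the genuine product vanishes on `(x/2, x]`
  there is nothing to prove; else the genuine boxes have exponents `e_i = log lo_i / log x ≥ 0` summing to
  `∈ [1 − δ/20, 1]`, Möbius ones `≤ 1/3 + δ/20`, and `trichotomy_slack` dispatches: window ⇒
  `typeII_dispatch`; a smooth exponent `≥ 1/2 + 21δ/10` forces that factor onto `L` ⇒ `typeI_dispatch_*`;
  two smooth exponents `> 1/2 − 3δ` force two indices onto `L`, impossible.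
-/

noncomputable section

namespace Summit.Parity.GeneralizedHardyLittlewood.Theorems.EngineToPairs.Sieve

open Finset Real
open scoped ArithmeticFunction.zeta ArithmeticFunction.Moebius ArithmeticFunction.sigma
open Literature.NumberTheory.Sieve Literature.NumberTheory.Sieve.BFI

set_option maxHeartbeats 800000 in
/-- **A fully boxed tuple with `#L ≤ 1` is Type II or Type I.** [this line] -/
theorem tuple_bound_boxed {δ x : ℝ} (hLx : Large δ x) (hδ : 0 < δ) (hδ' : δ ≤ 1 / 100)
    {Qs : Finset ℕ} {w : ℕ → ℕ → ℝ} {TI TII : ℝ} (hTI : 0 ≤ TI) (hTII : 0 ≤ TII)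
    (hfamI : TypeIFam Qs w x (1 / 2 - 2 * δ) 6 TI) (hfamII : TypeIIFam Qs w x (δ / 2) (1 / 3 + δ / 2) 6 TII)
    {U j : ℕ} (hj : 1 ≤ j) (hj3 : j ≤ 3) (hU : (U : ℝ) ≤ 2 * x ^ ((1 : ℝ) / 3))
    (L : Finset (Fin (2 * j))) (hL1 : L.card ≤ 1) (κ : Fin (2 * j) → ℕ) :
    ∑ q ∈ Qs, |corrFun (w q) x (fun n => (∏ i, gF x U j L κ i) n)| ≤ 4 * Real.log x ^ 2 * (TI + TII) := by
  classical
  -- notation and basic facts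
  have hx1 : 1 ≤ x := hLx.one_lt.le
  have hx0 : 0 < x := hLx.pos
  have hxlt : 1 < x := hLx.one_lt
  have hlog1 : 1 ≤ Real.log x := hLx.one_le_log
  have hlog0 : 0 < Real.log x := hLx.log_pos
  have hRHS : 0 ≤ 4 * Real.log x ^ 2 * (TI + TII) := by positivity
  have hsq0 : 0 ≤ Real.log x ^ 2 := sq_nonneg _
  have hb1 : Real.log x * TI ≤ 4 * Real.log x ^ 2 * (TI + TII) := by
    have e : 4 * Real.log x ^ 2 * (TI + TII) - Real.log x * TI =
        Real.log x * ((Real.log x - 1) * TI) + Real.log x ^ 2 * (3 * TI + 4 * TII) := by ring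
    have h1 : 0 ≤ Real.log x * ((Real.log x - 1) * TI) :=
      mul_nonneg hlog0.le (mul_nonneg (by linarith) hTI)
    have h2 : 0 ≤ Real.log x ^ 2 * (3 * TI + 4 * TII) := mul_nonneg hsq0 (by linarith)
    linarith
  have hb2 : 2 * Real.log x * Real.log x * TI ≤ 4 * Real.log x ^ 2 * (TI + TII) := by
    have e : 4 * Real.log x ^ 2 * (TI + TII) - 2 * Real.log x * Real.log x * TI =
        Real.log x ^ 2 * (2 * TI + 4 * TII) := by ring
    have h2 : 0 ≤ Real.log x ^ 2 * (2 * TI + 4 * TII) := mul_nonneg hsq0 (by linarith)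
    linarith
  have hb3 : Real.log x * Real.log x * TII ≤ 4 * Real.log x ^ 2 * (TI + TII) := by
    have e : 4 * Real.log x ^ 2 * (TI + TII) - Real.log x * Real.log x * TII =
        Real.log x ^ 2 * (4 * TI + 3 * TII) := by ring
    have h2 : 0 ≤ Real.log x ^ 2 * (4 * TI + 3 * TII) := mul_nonneg hsq0 (by linarith)
    linarith
  set V : ℝ := x ^ ((9 : ℝ) / 20) with hV
  have hV0 : 0 ≤ V := Real.rpow_nonneg hx0.le _
  set g : Fin (2 * j) → ArithmeticFunction ℝ := fun i => gF x U j L κ i with hg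
  set lo : Fin (2 * j) → ℝ := fun i => boxLow x 1 (κ i) with hlo
  have hlo0 : ∀ i, 0 < lo i := fun i => boxLow_pos hx0 (by norm_num) (κ i)
  have hcardι : Fintype.card (Fin (2 * j)) ≤ 6 := by rw [Fintype.card_fin]; omega
  have hcardle : ∀ S : Finset (Fin (2 * j)), S.card ≤ 6 := fun S => (Finset.card_le_univ S).trans hcardι
  -- Step 1: discard the unit boxes
  set Gen := univ.filter (fun i : Fin (2 * j) => (1 : ℝ) ≤ boxLow x 1 (κ i)) with hGen
  have hunits := corrFun_prod_units_le Qs w x κ (fun i => selF V U j L i)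
    (fun i => abs_box_selF_one_le x V U j L i (κ i))
  refine hunits.trans ?_
  change ∑ q ∈ Qs, |corrFun (w q) x (fun n => (∏ i ∈ Gen, g i) n)| ≤ _
  have hGenlo : ∀ i ∈ Gen, 1 ≤ lo i := fun i hi => (Finset.mem_filter.1 hi).2
  -- Step 2: if the genuine product vanishes on `(x/2, x]`, done
  by_cases hex : ∃ n ∈ Ioc ⌊x / 2⌋₊ ⌊x⌋₊, (∏ i ∈ Gen, g i) n ≠ 0
  swap
  · push Not at hex
    refine le_of_eq_of_le (Finset.sum_eq_zero fun q _ => ?_) hRHS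
    rw [abs_eq_zero]
    exact Finset.sum_eq_zero fun n hn => by dsimp only; rw [hex n hn, zero_mul]
  obtain ⟨n₀, hn₀, hne⟩ := hex
  have hn₀x : (n₀ : ℝ) ≤ x := (natLe_floor_iff hx0.le).1 (Finset.mem_Ioc.1 hn₀).2
  have hn₀x2 : x / 2 < n₀ := (Nat.floor_lt (by positivity)).1 (Finset.mem_Ioc.1 hn₀).1
  have hGenne : Gen.Nonempty := by
    by_contra hGe
    rw [Finset.not_nonempty_iff_eq_empty] at hGe
    rw [hGe, Finset.prod_empty, ArithmeticFunction.one_apply] at hne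
    have hn1 : n₀ ≠ 1 := by
      have h8 : 1 ≤ ⌊x / 2⌋₊ := Nat.le_floor (by norm_num; linarith [hLx.sixteen_le])
      have := (Finset.mem_Ioc.1 hn₀).1; omega
    exact hne (if_neg hn1)
  -- the product of the genuine lows
  set X' : ℝ := ∏ i ∈ Gen, lo i with hX'
  obtain ⟨hX'lt, hX'ge⟩ := prod_gF_support L κ hx0 hGenne hne
  have hX'pos : 0 < X' := Finset.prod_pos fun i _ => hlo0 i
  have hX'x : X' ≤ x := (hX'lt.le.trans hn₀x)
  have h2Gen : (2 : ℝ) ^ Gen.card ≤ 64 := by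
    calc (2 : ℝ) ^ Gen.card ≤ 2 ^ 6 := pow_le_pow_right₀ (by norm_num) (hcardle Gen)
      _ = 64 := by norm_num
  have hX'low : x / 128 < X' := by
    have : (n₀ : ℝ) ≤ 64 * X' := hX'ge.trans (mul_le_mul_of_nonneg_right h2Gen hX'pos.le)
    linarith
  -- exponents
  set e : Fin (2 * j) → ℝ := fun i => Real.log (lo i) / Real.log x with he
  have he_rpow : ∀ i, x ^ e i = lo i := fun i => rpow_log_div_log hxlt (hlo0 i)
  have he_nn : ∀ i ∈ Gen, 0 ≤ e i := fun i hi => log_div_log_nonneg hxlt (hGenlo i hi)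
  have hprod_e : ∀ S : Finset (Fin (2 * j)), ∏ i ∈ S, lo i = x ^ (∑ i ∈ S, e i) := fun S =>
    prod_eq_rpow_sum_log_div S hxlt lo (fun i _ => hlo0 i)
  have hsumGen : ∑ i ∈ Gen, e i = Real.log X' / Real.log x := by
    rw [he, ← Finset.sum_div, hX', Real.log_prod]
    exact fun i _ => (hlo0 i).ne'
  have hsum1 : ∑ i ∈ Gen, e i ≤ 1 := by
    rw [hsumGen, div_le_one hlog0]; exact Real.log_le_log hX'pos hX'x
  have hl2 : Real.log 2 / Real.log x ≤ δ / 140 := hLx.log_two_div_log_le hδ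
  have hsum2 : 1 - δ / 20 ≤ ∑ i ∈ Gen, e i := by
    rw [hsumGen, le_div_iff₀ hlog0]
    have h128 : Real.log (x / 128) = Real.log x - 7 * Real.log 2 := by
      rw [Real.log_div hx0.ne' (by norm_num), show (128 : ℝ) = 2 ^ 7 by norm_num, Real.log_pow]; ring
    have hlogX' : Real.log x - 7 * Real.log 2 ≤ Real.log X' := by
      rw [← h128]; exact Real.log_le_log (by positivity) hX'low.le
    have h7 : 7 * Real.log 2 ≤ δ / 20 * Real.log x := by
      rw [div_le_iff₀ hlog0] at hl2; linarith
    nlinarith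
  -- every genuine factor is non-zero at some `d ∣ n₀`
  have hfac : ∀ i ∈ Gen, ∃ d : ℕ, d ∣ n₀ ∧ g i d ≠ 0 := exists_ne_zero_of_prod_apply_ne_zero Gen hne
  -- Möbius exponents
  have hmu : ∀ i ∈ Gen, i.val < j → e i ≤ 1 / 3 + δ / 20 := by
    intro i hi hij
    obtain ⟨d, -, hd⟩ := hfac i hi
    have hlod : lo i < d := (gF_support L κ hd).1
    have hdU : d ≤ U := le_of_selF_ne_zero_moebius hij (boxRestrict_ne_zero hd).2
    have hlo2 : lo i < 2 * x ^ ((1 : ℝ) / 3) := by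
      have : (d : ℝ) ≤ U := by exact_mod_cast hdU
      linarith
    -- `x^{e i} = lo i < 2 x^{1/3} ≤ x^{1/3 + δ/140}` via `log 2 ≤ (δ/140) log x`
    have h2le : (2 : ℝ) * x ^ ((1 : ℝ) / 3) ≤ x ^ ((1 : ℝ) / 3 + δ / 140) := by
      rw [Real.rpow_add hx0, mul_comm]
      refine mul_le_mul_of_nonneg_left ?_ (Real.rpow_nonneg hx0.le _)
      have : Real.log 2 ≤ (δ / 140) * Real.log x := by rwa [div_le_iff₀ hlog0] at hl2
      calc (2 : ℝ) = Real.exp (Real.log 2) := (Real.exp_log two_pos).symm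
        _ ≤ Real.exp ((δ / 140) * Real.log x) := Real.exp_le_exp.2 this
        _ = x ^ (δ / 140) := by rw [Real.rpow_def_of_pos hx0, mul_comm]
    have : x ^ e i < x ^ ((1 : ℝ) / 3 + δ / 140) := by rw [he_rpow]; exact hlo2.trans_le h2le
    have := (Real.rpow_lt_rpow_left_iff hxlt).1 this
    linarith
  -- a smooth genuine factor with exponent `≥ 9/20` carries the high part, i.e. lies in `L`
  have hmemL : ∀ i ∈ Gen, j ≤ i.val → (9 : ℝ) / 20 ≤ e i → i ∈ L := by
    intro i hi hij hei
    by_contra hiL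
    obtain ⟨d, -, hd⟩ := hfac i hi
    have hlod : lo i < d := (gF_support L κ hd).1
    have hdV : (d : ℝ) ≤ V := le_of_selF_ne_zero_of_not_mem (mem_smoothIdx.2 hij) hiL (boxRestrict_ne_zero hd).2
    have : x ^ e i < x ^ ((9 : ℝ) / 20) := by rw [he_rpow]; exact hlod.trans_le hdV
    have := (Real.rpow_lt_rpow_left_iff hxlt).1 this
    linarith
  -- the padded exponent family on all of `Fin (2j)`
  set f : Fin (2 * j) → ℝ := fun i => if i ∈ Gen then e i else 0 with hf
  have hf_nn : ∀ i, 0 ≤ f i := fun i => by simp only [hf]; split_ifs with h; exacts [he_nn i h, le_rfl]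
  have hf_sum : ∑ i, f i = ∑ i ∈ Gen, e i := by
    rw [hf, Finset.sum_ite_mem, Finset.univ_inter]
  have hf_mu : ∀ i, ¬ (j ≤ i.val) → f i ≤ 1 / 3 + δ / 20 := by
    intro i hij
    simp only [hf]
    split_ifs with h
    · exact hmu i h (not_le.1 hij)
    · positivity
  have htri := trichotomy_slack f (fun i : Fin (2 * j) => j ≤ i.val) hδ hδ' hf_nn
    (by rw [hf_sum]; exact hsum1) (by rw [hf_sum]; exact hsum2) hf_mu
  -- the functional at the genuine product, unfolded
  have hcorr : ∀ q, corrFun (w q) x (fun n => (∏ i ∈ Gen, g i) n) =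
      ∑ n ∈ Ioc ⌊x / 2⌋₊ ⌊x⌋₊, (∏ i ∈ Gen, g i) n * w q n := fun q => rfl
  rcases htri with ⟨s, hs1, hs2⟩ | ⟨i₀, hsm, hbig⟩ | ⟨i, i', hne', hsi, hsi', h1, -, h2, -, -⟩
  · ---------------------------------------------------------------- Type II
    set S := s.filter (fun i => i ∈ Gen) with hS
    have hSsub : S ⊆ Gen := fun i hi => (Finset.mem_filter.1 hi).2
    have hSsum : ∑ i ∈ S, e i = ∑ i ∈ s, f i := by
      rw [hS, Finset.sum_filter]
    rw [← hSsum] at hs1 hs2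
    have hSne : S.Nonempty := by
      by_contra h; rw [Finset.not_nonempty_iff_eq_empty] at h
      rw [h, Finset.sum_empty] at hs1; linarith
    have hTne : (Gen \ S).Nonempty := by
      by_contra h; rw [Finset.not_nonempty_iff_eq_empty, Finset.sdiff_eq_empty_iff_subset] at h
      have : S = Gen := Finset.Subset.antisymm hSsub h
      rw [this] at hs2; linarith
    set α := ∏ i ∈ S, g i with hα
    set β := ∏ i ∈ Gen \ S, g i with hβ
    have heq : (∏ i ∈ Gen, g i) = α * β := by
      rw [hα, hβ]; exact (Finset.prod_sdiff hSsub).symm.trans (mul_comm _ _)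
    have hbound := typeII_dispatch hfamII hx1 (by linarith) α β hlog0 hlog0 ?_
      (fun m => abs_prod_gF_le hLx hj L κ S (hcardle S) m)
      (fun n => abs_prod_gF_le hLx hj L κ (Gen \ S) (hcardle _) n)
    · calc ∑ q ∈ Qs, |corrFun (w q) x (fun n => (∏ i ∈ Gen, g i) n)|
          = ∑ q ∈ Qs, |∑ n ∈ Ioc ⌊x / 2⌋₊ ⌊x⌋₊, (α * β) n * w q n| :=
            Finset.sum_congr rfl fun q _ => by rw [hcorr q, heq]
        _ ≤ Real.log x * Real.log x * TII := hbound
        _ ≤ 4 * Real.log x ^ 2 * (TI + TII) := hb3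
    -- support of `α` in the Type-II window
    intro m hm
    obtain ⟨hlow, hup⟩ := prod_gF_support L κ hx0 hSne hm
    rw [hprod_e S] at hlow hup
    constructor
    · calc (x / 2) ^ (δ / 2) ≤ x ^ (δ / 2) :=
            Real.rpow_le_rpow (by positivity) (by linarith) (by linarith)
        _ ≤ x ^ (∑ i ∈ S, e i) := Real.rpow_le_rpow_of_exponent_le hx1 (by linarith)
        _ < m := hlow
    · have h2S : (2 : ℝ) ^ S.card ≤ 64 := by
        calc (2 : ℝ) ^ S.card ≤ 2 ^ 6 := pow_le_pow_right₀ (by norm_num) (hcardle S)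
          _ = 64 := by norm_num
      have hxS : x ^ (∑ i ∈ S, e i) ≤ x ^ (1 / 3 + 9 * δ / 10) :=
        Real.rpow_le_rpow_of_exponent_le hx1 hs2
      calc (m : ℝ) ≤ 2 ^ S.card * x ^ (∑ i ∈ S, e i) := hup
        _ ≤ 64 * x ^ (1 / 3 + 9 * δ / 10) :=
            mul_le_mul h2S hxS (Real.rpow_nonneg hx0.le _) (by norm_num)
        _ ≤ x ^ (1 / 3 + 9 * δ / 10 + δ / 10) := hLx.sixtyfour_mul_rpow_le _
        _ = x ^ (δ / 2 + (1 / 3 + δ / 2)) := by ring_nf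
  · ---------------------------------------------------------------- Type I
    have hi₀Gen : i₀ ∈ Gen := by
      by_contra h
      simp only [hf, h, if_false] at hbig; linarith
    have hei₀ : 1 / 2 + 21 * δ / 10 ≤ e i₀ := by simpa only [hf, hi₀Gen, if_true] using hbig
    have hi₀L : i₀ ∈ L := hmemL i₀ hi₀Gen hsm (by linarith)
    set α := ∏ i ∈ Gen.erase i₀, g i with hα
    have heq : (∏ i ∈ Gen, g i) = α * g i₀ := by rw [hα, Finset.prod_erase_mul Gen g hi₀Gen]
    -- support of `α`: `m ≤ x^{1/2 - 2δ}`
    have hαsupp : ∀ m, α m ≠ 0 → (m : ℝ) ≤ x ^ (1 / 2 - 2 * δ) := by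
      intro m hm
      rcases (Gen.erase i₀).eq_empty_or_nonempty with hE | hE
      · rw [hα, hE, Finset.prod_empty, ArithmeticFunction.one_apply] at hm
        have : m = 1 := by by_contra h; exact hm (if_neg h)
        subst this
        rw [Nat.cast_one]; exact Real.one_le_rpow hx1 (by linarith)
      obtain ⟨-, hup⟩ := prod_gF_support L κ hx0 hE hm
      have hcard : (Gen.erase i₀).card ≤ 5 := by
        have := Finset.card_erase_of_mem hi₀Gen; have := hcardle Gen; omega
      have h2E : (2 : ℝ) ^ (Gen.erase i₀).card ≤ 32 := by
        calc (2 : ℝ) ^ (Gen.erase i₀).card ≤ 2 ^ 5 := pow_le_pow_right₀ (by norm_num) hcard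
          _ = 32 := by norm_num
      have hprodE : ∏ i ∈ Gen.erase i₀, lo i ≤ x ^ (1 / 2 - 21 * δ / 10) := by
        have hmul : (∏ i ∈ Gen.erase i₀, lo i) * lo i₀ = X' := Finset.prod_erase_mul Gen lo hi₀Gen
        have hloi : x ^ (1 / 2 + 21 * δ / 10) ≤ lo i₀ := by
          rw [← he_rpow]; exact Real.rpow_le_rpow_of_exponent_le hx1 hei₀
        have hP0 : 0 ≤ ∏ i ∈ Gen.erase i₀, lo i := Finset.prod_nonneg fun i _ => (hlo0 i).le
        have hsplitx : x = x ^ (1 / 2 - 21 * δ / 10) * x ^ (1 / 2 + 21 * δ / 10) := by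
          rw [← Real.rpow_add hx0]; norm_num
        by_contra hgt
        push Not at hgt
        have : x < (∏ i ∈ Gen.erase i₀, lo i) * lo i₀ := by
          calc x = x ^ (1 / 2 - 21 * δ / 10) * x ^ (1 / 2 + 21 * δ / 10) := hsplitx
            _ < (∏ i ∈ Gen.erase i₀, lo i) * x ^ (1 / 2 + 21 * δ / 10) :=
                mul_lt_mul_of_pos_right hgt (Real.rpow_pos_of_pos hx0 _)
            _ ≤ (∏ i ∈ Gen.erase i₀, lo i) * lo i₀ := mul_le_mul_of_nonneg_left hloi hP0
        rw [hmul] at this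
        linarith
      calc (m : ℝ) ≤ 2 ^ (Gen.erase i₀).card * ∏ i ∈ Gen.erase i₀, lo i := hup
        _ ≤ 32 * x ^ (1 / 2 - 21 * δ / 10) :=
            mul_le_mul h2E hprodE (Finset.prod_nonneg fun i _ => (hlo0 i).le) (by norm_num)
        _ ≤ x ^ (1 / 2 - 21 * δ / 10 + δ / 10) := hLx.thirtytwo_mul_rpow_le _
        _ = x ^ (1 / 2 - 2 * δ) := by ring_nf
    have hαb : ∀ m, |α m| ≤ Real.log x * tauPow 6 m := fun m =>
      abs_prod_gF_le hLx hj L κ (Gen.erase i₀) (hcardle _) m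
    have hγ1 : 1 / 2 - 2 * δ ≤ (1 : ℝ) := by linarith
    have hb : (⌊boxHigh x 1 (κ i₀)⌋₊ : ℝ) ≤ x := (Nat.floor_le (by
      have := boxHigh_eq_two_mul_boxLow x (κ i₀); rw [this]; linarith [hlo0 i₀])).trans (boxHigh_le hx0.le _)
    have ha : 1 ≤ max ⌊boxLow x 1 (κ i₀)⌋₊ ⌊V⌋₊ + 1 := by omega
    by_cases hi₀ℓ : i₀.val = 2 * j - 1
    · -- the free variable is the `log` factor
      have hβ : ∀ n, g i₀ n = if max ⌊boxLow x 1 (κ i₀)⌋₊ ⌊V⌋₊ + 1 ≤ n ∧ n ≤ ⌊boxHigh x 1 (κ i₀)⌋₊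
          then Real.log n else 0 := fun n => box_selF_log_high_apply hx0 hV0 hj hi₀ℓ hi₀L (κ i₀) n
      have hbound := typeI_dispatch_log hfamI hx1 hγ1 α (g i₀) hlog0 hαsupp hαb ha hb hβ
      calc ∑ q ∈ Qs, |corrFun (w q) x (fun n => (∏ i ∈ Gen, g i) n)|
          = ∑ q ∈ Qs, |∑ n ∈ Ioc ⌊x / 2⌋₊ ⌊x⌋₊, (α * g i₀) n * w q n| :=
            Finset.sum_congr rfl fun q _ => by rw [hcorr q, heq]
        _ ≤ 2 * Real.log x * Real.log x * TI := hbound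
        _ ≤ 4 * Real.log x ^ 2 * (TI + TII) := hb2
    · -- the free variable is a `ζ` factor
      have hβ : ∀ n, g i₀ n = if max ⌊boxLow x 1 (κ i₀)⌋₊ ⌊V⌋₊ + 1 ≤ n ∧ n ≤ ⌊boxHigh x 1 (κ i₀)⌋₊
          then 1 else 0 := fun n => box_selF_zeta_high_apply hx0 hV0 hsm hi₀ℓ hi₀L (κ i₀) n
      have hbound := typeI_dispatch_one hfamI hx1 hγ1 α (g i₀) hlog0 hαsupp hαb ha hβ
      calc ∑ q ∈ Qs, |corrFun (w q) x (fun n => (∏ i ∈ Gen, g i) n)|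
          = ∑ q ∈ Qs, |∑ n ∈ Ioc ⌊x / 2⌋₊ ⌊x⌋₊, (α * g i₀) n * w q n| :=
            Finset.sum_congr rfl fun q _ => by rw [hcorr q, heq]
        _ ≤ Real.log x * TI := hbound
        _ ≤ 4 * Real.log x ^ 2 * (TI + TII) := hb1
  · ---------------------------------------------------------------- two large smooth boxes: impossible
    exfalso
    have hiGen : i ∈ Gen := by
      by_contra h; simp only [hf, h, if_false] at h1; linarith
    have hi'Gen : i' ∈ Gen := by
      by_contra h; simp only [hf, h, if_false] at h2; linarith
    have hei : 1 / 2 - 3 * δ < e i := by simpa only [hf, hiGen, if_true] using h1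
    have hei' : 1 / 2 - 3 * δ < e i' := by simpa only [hf, hi'Gen, if_true] using h2
    have hiL : i ∈ L := hmemL i hiGen hsi (by linarith)
    have hi'L : i' ∈ L := hmemL i' hi'Gen hsi' (by linarith)
    have : 2 ≤ L.card := by
      have hsub : ({i, i'} : Finset (Fin (2 * j))) ⊆ L := by
        intro k hk
        rcases Finset.mem_insert.1 hk with rfl | hk
        · exact hiL
        · rw [Finset.mem_singleton.1 hk]; exact hi'L
      have := Finset.card_le_card hsub
      rwa [Finset.card_pair hne'] at this
    omega

end Summit.Parity.GeneralizedHardyLittlewood.Theorems.EngineToPairs.Sieve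

namespace Summit.Parity.GeneralizedHardyLittlewood.Theorems.EngineToPairs

/-- Registered sub-goal of `stub_sieve` carried by this part (landing mechanics): the cardinality of a
two-element set (used to contradict `#L ≤ 1`). [folklore] -/
theorem sieve_part6b_anchor : ∀ (n : ℕ) (a b : Fin n), a ≠ b → ({a, b} : Finset (Fin n)).card = 2 :=
  fun _ _ _ h => Finset.card_pair h

end Summit.Parity.GeneralizedHardyLittlewood.Theorems.EngineToPairs

end
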